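import Summits.Langlands.Langlands.Theorems.PrimitiveRankLadderRankOneAutomorphyOfHeckeDictionary
import Literature.NumberTheory.GaloisRepresentations.DeRhamLAdicCharacterHeckeReduction
import HarnessLib

/-!
# R1 `PrimitiveRankLadder.RankOneAutomorphy` (stmt-Langlands-24805) ⟸ Tate's local theorem ALONE

Support file (closes nothing) for the open SUPPORT leaf R1 = `RankOneAutomorphy` of the decomp-langlands rank
ladders (item stmt-Langlands-24805; routes PrimitiveRankLadder, EllipticDegreeLadder, TriangularRankLadder,
ParityLadder, MonodromyDichotomy, DescentTypeTrichotomy, PolarisationCarving).  decomp-langlands lens-5 gen 25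
node, second half (the DAG edge proper); first half = `PrimitiveRankLadderRankOneAutomorphyOfHeckeDictionary`
(the unconditional fibre kernel: algebraic Hecke character with the Frobenius dictionary ⟹ cuspidal
L-algebraic `π` of `GL₁(𝔸_K)` Satake–Frobenius compatible a.e., and R1 from the TEXT of the named fact
`FramedGaloisRep.exists_heckeCharacter_of_isDeRhamFramed`).

## What is proved (0 sorry)

* `rankOneAutomorphy_of_namedFact : FramedGaloisRep.exists_heckeCharacter_of_isDeRhamFramed →
    PrimitiveRankLadder.RankOneAutomorphy` — R1 BY NAME from the catalogued named fact BY NAME (Patrikis 2019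
  Prop. 2.2.1; Serre 1968 Ch. III §2.3 Thm. 2 with App. A), by `Iff.rfl` from the first half.
* `rankOneAutomorphy_of_local (hloc) : PrimitiveRankLadder.RankOneAutomorphy` — R1 BY NAME from the ONE LOCAL
  input `hloc` of the tree's reduction `FramedGaloisRep.exists_heckeCharacter_of_isDeRhamFramed_of_local`
  (binder copied VERBATIM from `DeRhamLAdicCharacterHeckeReduction`): Tate's theorem that a de Rham rank-one
  character `ρ : Γ_F →ₜ* GL₁(ℚ̄_ℓ)` of a characteristic-`0` non-archimedean local field `F` (`|ℓ|_F < 1`,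
  Fontaine's datum `fontainePst F ℓ hF`) is locally algebraic: there are an open `V ≤ Fˣ`, finitely many
  continuous embeddings `e : F → ℚ̄_ℓ` and integers `n_e` with `ρ(w)₀₀ = ∏_e e(Art_F w)^{n_e}` for every
  inertial `w ∈ W_F` with `Art_F w ∈ V` (Serre III App. A6 Cor. 2; Conrad 2011 App. B Def. B.1 / Prop. B.4).
  `hloc` is NOT proved in the tree — it needs Sen's theorem ("ℂ_p-admissible ⟹ potentially unramified";
  named facts `PAdicHodge.SenFiniteness`, `PAdicHodge.SenOperatorExistsUnique`) and the Hodge–Tate periods of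
  the Lubin–Tate characters (Serre III App. A4–A5).  THIS FILE MAKES IT THE SINGLE REMAINING INPUT OF R1:
  `PrimitiveRankLadder.RankOneAutomorphy` (hence the R1 binder of all seven routes, dedup-shared) closes by
  `rankOneAutomorphy_of_local h` the day `hloc` is discharged; no automorphic input beyond Borel–Jacquet `GL₁`,
  no irreducibility and no unramified-a.e. clause is used.

## References

* [SerreAbelianLadic1968] J.-P. Serre, *Abelian ℓ-adic representations and elliptic curves* (1968), Ch. III
  §2.3 Thm. 2, App. A6 Cor. 2.
* [Conrad2011LiftingGlobal] B. Conrad, *Lifting global representations with local properties*, App. B,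
  Def. B.1, Prop. B.4.
* [Patrikis2019] S. Patrikis, *Variations on a theorem of Tate*, Mem. AMS 1238 (2019), Prop. 2.2.1.
-/

set_option linter.dupNamespace false

noncomputable section

open scoped NumberField Classical Polynomial MatrixGroups Matrix
open Filter IsDedekindDomain Field Polynomial
open Literature.NumberTheory.Automorphic Literature.NumberTheory.GaloisRepresentations
open Literature.NumberTheory.PAdicHodge
open Summit.Langlands

namespace Summit.Langlands.Langlands.Theorems.PrimitiveRankLadderRankOneAutomorphyOfTateLocal

/-- **R1 `PrimitiveRankLadder.RankOneAutomorphy` (stmt-Langlands-24805) from the named fact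
`FramedGaloisRep.exists_heckeCharacter_of_isDeRhamFramed` BY NAME** (Patrikis 2019 Prop. 2.2.1; Serre III
§2.3 Thm. 2 + App. A) — the first half's `rankOneAutomorphy_of_heckeCharacterFact`, whose hypothesis is the
fact's text verbatim. [cite: Patrikis2019, Prop. 2.2.1] [cite: SerreAbelianLadic1968, Ch. III §2.3 Thm. 2] -/
theorem rankOneAutomorphy_of_namedFact (h : FramedGaloisRep.exists_heckeCharacter_of_isDeRhamFramed) :
    Theses.PrimitiveRankLadder.RankOneAutomorphy :=
  PrimitiveRankLadderRankOneAutomorphyOfHeckeDictionary.rankOneAutomorphy_of_heckeCharacterFact h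

/-- **R1 `PrimitiveRankLadder.RankOneAutomorphy` (stmt-Langlands-24805) from TATE'S LOCAL THEOREM ALONE.**
`hloc` is, VERBATIM, the single local hypothesis of the tree's reduction
`FramedGaloisRep.exists_heckeCharacter_of_isDeRhamFramed_of_local` (Serre III App. A6 Cor. 2; Conrad 2011
App. B Def. B.1 / Prop. B.4): a de Rham rank-one character of a characteristic-`0` local field is algebraic
near `1` on inertia.  The DAG edge: R1 is one local `p`-adic Hodge theory input (Sen) away from closing.
[cite: SerreAbelianLadic1968, App. A6 Cor. 2] [cite: Conrad2011LiftingGlobal, App. B, Prop. B.4] -/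
theorem rankOneAutomorphy_of_local
    (hloc : ∀ (F : Type) [Field F] [ValuativeRel F] [TopologicalSpace F] [IsNonarchimedeanLocalField F]
      [CharZero F] (ℓ : ℕ) [Fact ℓ.Prime] (hF : ValuativeRel.valuation F (ℓ : F) < 1)
      (ρ : FramedRep (absoluteGaloisGroup F) (PadicAlgCl ℓ) 1),
      (Literature.NumberTheory.PAdicHodge.fontainePst F ℓ hF).IsDeRhamFramed ρ →
        ∃ V : Subgroup Fˣ, IsOpen (V : Set Fˣ) ∧
          ∃ (s : Finset (F →+* PadicAlgCl ℓ)) (n : (F →+* PadicAlgCl ℓ) → ℤ), (∀ e ∈ s, Continuous e) ∧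
            ∀ w ∈ WeilGroup.inertia F, canonicalArtin F w ∈ V →
              ((ρ (WeilGroup.toAbsGalois F w) : GL (Fin 1) (PadicAlgCl ℓ)) :
                  Matrix (Fin 1) (Fin 1) (PadicAlgCl ℓ)) 0 0 =
                ∏ e ∈ s, e ((canonicalArtin F w : Fˣ) : F) ^ n e) :
    Theses.PrimitiveRankLadder.RankOneAutomorphy :=
  rankOneAutomorphy_of_namedFact (FramedGaloisRep.exists_heckeCharacter_of_isDeRhamFramed_of_local hloc)

end Summit.Langlands.Langlands.Theorems.PrimitiveRankLadderRankOneAutomorphyOfTateLocal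

end
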